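import Summits.BirchSwinnertonDyer.BirchSwinnertonDyer.Theorems.AlignedTransportAtTwoMainConjectureOfRankZeroBSDAtTwoCubicSplitStratumRelationDoor
import Literature.NumberTheory.IwasawaTheory.ClassicalMuVanishesLayerTwoRelationMatrixCertificateTwo
import HarnessLib

/-!
# Route `AlignedTransportAtTwo`, crux C2 `MainConjectureOfRankZeroBSDAtTwo` (stmt-BirchSwinnertonDyer-22298):
# THE TWO-GENERATOR RELATION DOOR IN COORDINATES for the cubic `2`-division field `ℚ(β)` — two degree-one primes `(q_k, s₂ − t_k)` of `K_2 = ℚ(β)·ℚ(ζ₁₆)⁺`,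
# three dyadic symbols, two exponent rows with determinant `(X−1)^d·u + 2·g` (`d ≤ 2`), two elements certified by memberships and norms ⟹ `rank₂ Cl(K_m) ≤ d ∀ m`,
# `μ₂(κ) = 0`, `λ₂(κ) ≤ d` for every cyclotomic `ℤ₂`-extension `κ` of `ℚ(β)`

HONEST FRAMING (cell `bsd-f1-sign2`, WIDTH-5 attached prover seat `bsd-line-att-p3` gen 54 on line `birth` of the lead `bsd-line-att-p2`; `--supports`
stmt-BirchSwinnertonDyer-22298, closes nothing; BSD is NOT proved by any of this; the crux C2, its verdict «blocked-on `Rank1Residual.GreenbergMuConjectureIrreducible`»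
and every registered stub are untouched).  THEOREMS ONLY — no definition, no named fact, no `sorry`.

WHAT.  The `W`-level form of this seat's Literature theorem `IwasawaTheory.classicalMuVanishes_two_of_relationMatrixCert_layer_two`
(`IwasawaTheory/ClassicalMuVanishesLayerTwoRelationMatrixCertificateTwo`, g54 — the COORDINATE KERNEL of the two-generator relation door): `W/ℚ` with no rational
`2`-torsion abscissa and `Δ_W < 0`, `β` a root of the `2`-division cubic, `K = ℚ(β)`; displayed `h_K` odd, `2 ∤ d_K`, a unit `ε` with `±ε` non-squares and `ε ≡ ±1`
modulo the cubes of three norm-`2` ideals `𝔭_a, 𝔭_b, 𝔭_c`; ROW DATA in `𝓞_K`: `q₁, q₂` generating distinct maximal ideals with `q₁ ≡ ±3 (mod 𝔭_a³)`, `q₂ ≡ ±3 (mod 𝔭_b³)`,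
`q₁q₂ ≡ ±3 (mod 𝔭_c³)`; `t₁, t₂ ∈ ℤ` with residue maps, norm-Bézout and coprimality witnesses; exponent rows `e₁|g₁`, `e₂|g₂ : ℕ → ℕ` (values at `0…3`) with
`E₁G₂ − G₁E₂ = (X−1)^d·u + 2·g`, `u(1)` odd, `d + 2 ≤ 4`; two elements `y, z` (coordinates on `1, s₁, s₂, s₁s₂`) with eight membership certificates each and norms
`N(y) = ε_y q₁^{Σe₁} q₂^{Σg₁}`, `N(z) = ε_z q₁^{Σe₂} q₂^{Σg₂}`.  THEN for the given cyclotomic `ℤ₂`-extension `κ` of `ℚ(β)`: **`rank₂ Cl(K_m) ≤ d ∀ m`, `μ₂(κ) = 0`,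
`λ₂(κ) ≤ d`.**  A ROW (successor / kit seat; habitat: the split-stratum field `−1727`, seeds `1727a1 / 29359b1 / 29359d1`) discharges every displayed identity by
`linear_combination` in `𝓞_K` (on a `(1, θ, δ)` basis — the field is non-monogenic) and every residue by `decide`.

CELL READING: nothing about any curve is asserted HERE; BSD is not proved; nothing is closed.

References: [Washington1997] §13.3 Prop. 13.22–13.23; [Lang1990] Ch. 5 §3, Ch. 13 §4 Lemma 4.1; [Gras2003] IV.4; [Fukuda1994] Thm. 1; [NeukirchANT1999] Ch. I §3, §8, §9,
Ch. III (1.6)–(1.7); [Cohen1993] §4.7, §6.5; [Omeara1963] §63B; tree: this seat's `…CubicSplitStratumRelationMatrixDoor` (p835778) and Literature files p835621 /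
p835694 / p835733 / `ClassicalMuVanishesLayerTwoRelationMatrixCertificateTwo`.
-/

set_option linter.dupNamespace false
set_option autoImplicit false

noncomputable section

open scoped Classical NumberField nonZeroDivisors

namespace Summit.BirchSwinnertonDyer.BirchSwinnertonDyer.Theorems.AlignedTransportAtTwoCubicSplitStratumRelationMatrixCoordDoor

open NumberField IsDedekindDomain Polynomial WeierstrassCurve IntermediateField CongruenceSubgroup Finset
  Literature.NumberTheory.IwasawaTheory Literature.NumberTheory.GaloisRepresentations
  Literature.NumberTheory.GaloisRepresentations.Herbrand Literature.NumberTheory.GaloisRepresentations.MinkowskiUnit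
  Literature.NumberTheory.GaloisRepresentations.CyclicNormIndex
  Literature.NumberTheory.EllipticCurves Literature.NumberTheory.EllipticCurves.Greenberg1999
  Literature.NumberTheory.EllipticCurves.ModularForms
  Literature.NumberTheory.EllipticCurves.Rank1Residual
  Literature.NumberTheory.EllipticCurves.Module
  Literature.NumberTheory.NumberFields Literature.NumberTheory.NumberFields.AmbiguousClass
  Summit.BirchSwinnertonDyer.Rank1Residual
  Summit.BirchSwinnertonDyer.Rank1Residual.X1.MuLambda
  Summit.BirchSwinnertonDyer.Rank1Residual.X5
  Summit.BirchSwinnertonDyer.Rank1Residual.F1Sign2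
  Summit.BirchSwinnertonDyer.BirchSwinnertonDyer.Theorems.Rank1ResidualX1Defs
  Summit.BirchSwinnertonDyer.BirchSwinnertonDyer.Theses.AlignedTransportAtTwo
  Summit.BirchSwinnertonDyer.BirchSwinnertonDyer.Theorems.AlignedTransportAtTwoKilfordStratumShared
  Summit.BirchSwinnertonDyer.BirchSwinnertonDyer.Theorems.AlignedTransportAtTwoCubicCarrierRoad
  Summit.BirchSwinnertonDyer.BirchSwinnertonDyer.Theorems.AlignedTransportAtTwoCubicKilfordPrimes
  Summit.BirchSwinnertonDyer.BirchSwinnertonDyer.Theorems.AlignedTransportAtTwoCubicDepthDoorGenusCert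
  Summit.BirchSwinnertonDyer.BirchSwinnertonDyer.Theorems.AlignedTransportAtTwoCubicPrimesOfEmbeddings
  Summit.BirchSwinnertonDyer.BirchSwinnertonDyer.Theorems.AlignedTransportAtTwoCubicLayerOneDoors
  Summit.BirchSwinnertonDyer.BirchSwinnertonDyer.Theorems.AlignedTransportAtTwoFineRoad.RealKummerLinesPadicLetterOnPointsPrimes

variable (W : WeierstrassCurve ℚ) [W.IsElliptic]

set_option synthInstance.maxHeartbeats 400000 in
set_option maxHeartbeats 3200000 in
/-- **THE TWO-GENERATOR RELATION DOOR IN COORDINATES for `ℚ(β)`** (hypotheses as in the module docstring; conclusion: `rank₂ Cl(K_m) ≤ d ∀ m`, `μ₂(κ) = 0`,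
`λ₂(κ) ≤ d` for the given cyclotomic `ℤ₂`-extension `κ` of `ℚ(β)`). [cite: Washington1997, §13.3 Prop. 13.22–13.23] [cite: Lang1990, Ch. 5 §3 and Ch. 13 §4, Lemma 4.1]
[cite: Gras2003, IV.4] [cite: NeukirchANT1999, Ch. III (1.6)–(1.7); Ch. I §3 (3.3)] [cite: Cohen1993, §4.7, §6.5] -/
theorem classicalMuVanishes_adjoin_of_relationMatrixCert_layer_two
    (ht : ∀ x : ℚ, ¬ HasRationalTwoTorsionX W x) (hΔ : W.Δ < 0)
    {β : AlgebraicClosure ℚ} (hβ : aeval β W.twoTorsionPolynomial.toPoly = 0)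
    (hh : haveI : FiniteDimensional ℚ ↥(IntermediateField.adjoin ℚ ({β} : Set (AlgebraicClosure ℚ))) :=
        IntermediateField.adjoin.finiteDimensional ((AlgebraicClosure.isAlgebraic ℚ).isAlgebraic β).isIntegral
      haveI : NumberField ↥(IntermediateField.adjoin ℚ ({β} : Set (AlgebraicClosure ℚ))) := NumberField.mk
      ¬ 2 ∣ classNumber ↥(IntermediateField.adjoin ℚ ({β} : Set (AlgebraicClosure ℚ))))
    (hd : haveI : FiniteDimensional ℚ ↥(IntermediateField.adjoin ℚ ({β} : Set (AlgebraicClosure ℚ))) :=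
        IntermediateField.adjoin.finiteDimensional ((AlgebraicClosure.isAlgebraic ℚ).isAlgebraic β).isIntegral
      haveI : NumberField ↥(IntermediateField.adjoin ℚ ({β} : Set (AlgebraicClosure ℚ))) := NumberField.mk
      ¬ (2 : ℤ) ∣ NumberField.discr ↥(IntermediateField.adjoin ℚ ({β} : Set (AlgebraicClosure ℚ))))
    {ε : (𝓞 ↥(IntermediateField.adjoin ℚ ({β} : Set (AlgebraicClosure ℚ))))ˣ} (hnsq : ∀ w : (𝓞 ↥(IntermediateField.adjoin ℚ ({β} : Set (AlgebraicClosure ℚ))))ˣ, ε ≠ w ^ 2 ∧ ε ≠ -w ^ 2)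
    (𝔭a 𝔭b 𝔭c : Ideal (𝓞 ↥(IntermediateField.adjoin ℚ ({β} : Set (AlgebraicClosure ℚ)))))
    (hNa : haveI : FiniteDimensional ℚ ↥(IntermediateField.adjoin ℚ ({β} : Set (AlgebraicClosure ℚ))) :=
        IntermediateField.adjoin.finiteDimensional ((AlgebraicClosure.isAlgebraic ℚ).isAlgebraic β).isIntegral
      haveI : NumberField ↥(IntermediateField.adjoin ℚ ({β} : Set (AlgebraicClosure ℚ))) := NumberField.mk
      Ideal.absNorm 𝔭a = 2)
    (hNb : haveI : FiniteDimensional ℚ ↥(IntermediateField.adjoin ℚ ({β} : Set (AlgebraicClosure ℚ))) :=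
        IntermediateField.adjoin.finiteDimensional ((AlgebraicClosure.isAlgebraic ℚ).isAlgebraic β).isIntegral
      haveI : NumberField ↥(IntermediateField.adjoin ℚ ({β} : Set (AlgebraicClosure ℚ))) := NumberField.mk
      Ideal.absNorm 𝔭b = 2)
    (hNc : haveI : FiniteDimensional ℚ ↥(IntermediateField.adjoin ℚ ({β} : Set (AlgebraicClosure ℚ))) :=
        IntermediateField.adjoin.finiteDimensional ((AlgebraicClosure.isAlgebraic ℚ).isAlgebraic β).isIntegral
      haveI : NumberField ↥(IntermediateField.adjoin ℚ ({β} : Set (AlgebraicClosure ℚ))) := NumberField.mk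
      Ideal.absNorm 𝔭c = 2)
    (hεa : (ε : 𝓞 ↥(IntermediateField.adjoin ℚ ({β} : Set (AlgebraicClosure ℚ)))) - 1 ∈ 𝔭a ^ 3 ∨ (ε : 𝓞 ↥(IntermediateField.adjoin ℚ ({β} : Set (AlgebraicClosure ℚ)))) + 1 ∈ 𝔭a ^ 3)
    (hεb : (ε : 𝓞 ↥(IntermediateField.adjoin ℚ ({β} : Set (AlgebraicClosure ℚ)))) - 1 ∈ 𝔭b ^ 3 ∨ (ε : 𝓞 ↥(IntermediateField.adjoin ℚ ({β} : Set (AlgebraicClosure ℚ)))) + 1 ∈ 𝔭b ^ 3)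
    (hεc : (ε : 𝓞 ↥(IntermediateField.adjoin ℚ ({β} : Set (AlgebraicClosure ℚ)))) - 1 ∈ 𝔭c ^ 3 ∨ (ε : 𝓞 ↥(IntermediateField.adjoin ℚ ({β} : Set (AlgebraicClosure ℚ)))) + 1 ∈ 𝔭c ^ 3)
    (κP : ZpExtension ↥(IntermediateField.adjoin ℚ ({β} : Set (AlgebraicClosure ℚ))) 2) (hκP : κP.IsCyclotomic)
    -- the two primes below and their dyadic symbols
    (q₁ q₂ : 𝓞 ↥(IntermediateField.adjoin ℚ ({β} : Set (AlgebraicClosure ℚ)))) (hq₁ : (Ideal.span {q₁}).IsMaximal) (hq₂ : (Ideal.span {q₂}).IsMaximal)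
    (a₁₂ c₁₂ : 𝓞 ↥(IntermediateField.adjoin ℚ ({β} : Set (AlgebraicClosure ℚ)))) (hq₁₂ : a₁₂ * q₁ + c₁₂ * q₂ = 1)
    (hπa : q₁ - 3 ∈ 𝔭a ^ 3 ∨ q₁ + 3 ∈ 𝔭a ^ 3) (hπb : q₂ - 3 ∈ 𝔭b ^ 3 ∨ q₂ + 3 ∈ 𝔭b ^ 3) (hπc : q₁ * q₂ - 3 ∈ 𝔭c ^ 3 ∨ q₁ * q₂ + 3 ∈ 𝔭c ^ 3)
    -- the two primes above: residue symbols, norm-Bézout data, coprimality of the conjugates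
    (t₁ t₂ : ℤ) {m₁ m₂ : ℕ} (hm₁ : 1 < m₁) (hm₂ : 1 < m₂) (ψ₁ : 𝓞 ↥(IntermediateField.adjoin ℚ ({β} : Set (AlgebraicClosure ℚ))) →+* ZMod m₁) (ψ₂ : 𝓞 ↥(IntermediateField.adjoin ℚ ({β} : Set (AlgebraicClosure ℚ))) →+* ZMod m₂) (hψ₁ : ψ₁ q₁ = 0) (hψ₂ : ψ₂ q₂ = 0)
    {ti₁ : ZMod m₁} {ti₂ : ZMod m₂} (hti₁ : 2 * ti₁ = 1) (hti₂ : 2 * ti₂ = 1)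
    (hPt₁ : ((t₁ : ZMod m₁) ^ 2 - 2) ^ 2 - 2 = 0) (hPt₂ : ((t₂ : ZMod m₂) ^ 2 - 2) ^ 2 - 2 = 0)
    (α₁ β₁ : 𝓞 ↥(IntermediateField.adjoin ℚ ({β} : Set (AlgebraicClosure ℚ)))) (hBez₁ : α₁ * q₁ ^ 4 + β₁ * (((t₁ : 𝓞 ↥(IntermediateField.adjoin ℚ ({β} : Set (AlgebraicClosure ℚ)))) ^ 2 - 2) ^ 2 - 2) = q₁)
    (α₂ β₂ : 𝓞 ↥(IntermediateField.adjoin ℚ ({β} : Set (AlgebraicClosure ℚ)))) (hBez₂ : α₂ * q₂ ^ 4 + β₂ * (((t₂ : 𝓞 ↥(IntermediateField.adjoin ℚ ({β} : Set (AlgebraicClosure ℚ)))) ^ 2 - 2) ^ 2 - 2) = q₂)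
    (α₁₁ v₁₁ : 𝓞 ↥(IntermediateField.adjoin ℚ ({β} : Set (AlgebraicClosure ℚ)))) (hC₁₁ : α₁₁ * q₁ + v₁₁ * ((t₁ : 𝓞 ↥(IntermediateField.adjoin ℚ ({β} : Set (AlgebraicClosure ℚ)))) ^ 3 - 4 * (t₁ : 𝓞 ↥(IntermediateField.adjoin ℚ ({β} : Set (AlgebraicClosure ℚ))))) = 1)
    (α₁₂ v₁₂ : 𝓞 ↥(IntermediateField.adjoin ℚ ({β} : Set (AlgebraicClosure ℚ)))) (hC₁₂ : α₁₂ * q₁ + v₁₂ * (-2 * (t₁ : 𝓞 ↥(IntermediateField.adjoin ℚ ({β} : Set (AlgebraicClosure ℚ))))) = 1)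
    (α₁₃ v₁₃ : 𝓞 ↥(IntermediateField.adjoin ℚ ({β} : Set (AlgebraicClosure ℚ)))) (hC₁₃ : α₁₃ * q₁ + v₁₃ * (-(t₁ : 𝓞 ↥(IntermediateField.adjoin ℚ ({β} : Set (AlgebraicClosure ℚ)))) ^ 3 + 2 * (t₁ : 𝓞 ↥(IntermediateField.adjoin ℚ ({β} : Set (AlgebraicClosure ℚ))))) = 1)
    (α₂₁ v₂₁ : 𝓞 ↥(IntermediateField.adjoin ℚ ({β} : Set (AlgebraicClosure ℚ)))) (hC₂₁ : α₂₁ * q₂ + v₂₁ * ((t₂ : 𝓞 ↥(IntermediateField.adjoin ℚ ({β} : Set (AlgebraicClosure ℚ)))) ^ 3 - 4 * (t₂ : 𝓞 ↥(IntermediateField.adjoin ℚ ({β} : Set (AlgebraicClosure ℚ))))) = 1)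
    (α₂₂ v₂₂ : 𝓞 ↥(IntermediateField.adjoin ℚ ({β} : Set (AlgebraicClosure ℚ)))) (hC₂₂ : α₂₂ * q₂ + v₂₂ * (-2 * (t₂ : 𝓞 ↥(IntermediateField.adjoin ℚ ({β} : Set (AlgebraicClosure ℚ))))) = 1)
    (α₂₃ v₂₃ : 𝓞 ↥(IntermediateField.adjoin ℚ ({β} : Set (AlgebraicClosure ℚ)))) (hC₂₃ : α₂₃ * q₂ + v₂₃ * (-(t₂ : 𝓞 ↥(IntermediateField.adjoin ℚ ({β} : Set (AlgebraicClosure ℚ)))) ^ 3 + 2 * (t₂ : 𝓞 ↥(IntermediateField.adjoin ℚ ({β} : Set (AlgebraicClosure ℚ))))) = 1)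
    -- the two exponent rows and their determinant
    (e₁ g₁ e₂ g₂ : ℕ → ℕ) {d : ℕ} (hd2 : d + 2 ≤ 4) {u g : ℤ[X]} (hu : ¬ (2 : ℤ) ∣ u.eval 1)
    (hF : (∑ i ∈ range 4, C ((e₁ i : ℕ) : ℤ) * X ^ i : ℤ[X]) * (∑ i ∈ range 4, C ((g₂ i : ℕ) : ℤ) * X ^ i) -
        (∑ i ∈ range 4, C ((g₁ i : ℕ) : ℤ) * X ^ i) * (∑ i ∈ range 4, C ((e₂ i : ℕ) : ℤ) * X ^ i) = (X - 1) ^ d * u + C (2 : ℤ) * g)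
    -- row 1
    (y₀ y₁ y₂ y₃ : 𝓞 ↥(IntermediateField.adjoin ℚ ({β} : Set (AlgebraicClosure ℚ))))
    (hy1q0 : ∀ (R : Type) [CommRing R] (φ : 𝓞 ↥(IntermediateField.adjoin ℚ ({β} : Set (AlgebraicClosure ℚ))) →+* R) (S₁ S₂ : R), S₁ ^ 2 = 2 → S₂ ^ 2 = 2 + S₁ →
      ∃ c : ℕ → R, φ y₀ + φ y₁ * S₁ + (φ y₂ + φ y₃ * S₁) * S₂ =
        ∑ k ∈ Finset.range (e₁ 0 + 1), c k * φ q₁ ^ (e₁ 0 - k) * (S₂ - (t₁ : R)) ^ k)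
    (hy1q1 : ∀ (R : Type) [CommRing R] (φ : 𝓞 ↥(IntermediateField.adjoin ℚ ({β} : Set (AlgebraicClosure ℚ))) →+* R) (S₁ S₂ : R), S₁ ^ 2 = 2 → S₂ ^ 2 = 2 + S₁ →
      ∃ c : ℕ → R, φ y₀ + φ y₁ * S₁ + (φ y₂ + φ y₃ * S₁) * S₂ =
        ∑ k ∈ Finset.range (e₁ 1 + 1), c k * φ q₁ ^ (e₁ 1 - k) * (S₁ * S₂ - S₂ - (t₁ : R)) ^ k)
    (hy1q2 : ∀ (R : Type) [CommRing R] (φ : 𝓞 ↥(IntermediateField.adjoin ℚ ({β} : Set (AlgebraicClosure ℚ))) →+* R) (S₁ S₂ : R), S₁ ^ 2 = 2 → S₂ ^ 2 = 2 + S₁ →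
      ∃ c : ℕ → R, φ y₀ + φ y₁ * S₁ + (φ y₂ + φ y₃ * S₁) * S₂ =
        ∑ k ∈ Finset.range (e₁ 2 + 1), c k * φ q₁ ^ (e₁ 2 - k) * (-S₂ - (t₁ : R)) ^ k)
    (hy1q3 : ∀ (R : Type) [CommRing R] (φ : 𝓞 ↥(IntermediateField.adjoin ℚ ({β} : Set (AlgebraicClosure ℚ))) →+* R) (S₁ S₂ : R), S₁ ^ 2 = 2 → S₂ ^ 2 = 2 + S₁ →
      ∃ c : ℕ → R, φ y₀ + φ y₁ * S₁ + (φ y₂ + φ y₃ * S₁) * S₂ =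
        ∑ k ∈ Finset.range (e₁ 3 + 1), c k * φ q₁ ^ (e₁ 3 - k) * (S₂ - S₁ * S₂ - (t₁ : R)) ^ k)
    (hy2q0 : ∀ (R : Type) [CommRing R] (φ : 𝓞 ↥(IntermediateField.adjoin ℚ ({β} : Set (AlgebraicClosure ℚ))) →+* R) (S₁ S₂ : R), S₁ ^ 2 = 2 → S₂ ^ 2 = 2 + S₁ →
      ∃ c : ℕ → R, φ y₀ + φ y₁ * S₁ + (φ y₂ + φ y₃ * S₁) * S₂ =
        ∑ k ∈ Finset.range (g₁ 0 + 1), c k * φ q₂ ^ (g₁ 0 - k) * (S₂ - (t₂ : R)) ^ k)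
    (hy2q1 : ∀ (R : Type) [CommRing R] (φ : 𝓞 ↥(IntermediateField.adjoin ℚ ({β} : Set (AlgebraicClosure ℚ))) →+* R) (S₁ S₂ : R), S₁ ^ 2 = 2 → S₂ ^ 2 = 2 + S₁ →
      ∃ c : ℕ → R, φ y₀ + φ y₁ * S₁ + (φ y₂ + φ y₃ * S₁) * S₂ =
        ∑ k ∈ Finset.range (g₁ 1 + 1), c k * φ q₂ ^ (g₁ 1 - k) * (S₁ * S₂ - S₂ - (t₂ : R)) ^ k)
    (hy2q2 : ∀ (R : Type) [CommRing R] (φ : 𝓞 ↥(IntermediateField.adjoin ℚ ({β} : Set (AlgebraicClosure ℚ))) →+* R) (S₁ S₂ : R), S₁ ^ 2 = 2 → S₂ ^ 2 = 2 + S₁ →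
      ∃ c : ℕ → R, φ y₀ + φ y₁ * S₁ + (φ y₂ + φ y₃ * S₁) * S₂ =
        ∑ k ∈ Finset.range (g₁ 2 + 1), c k * φ q₂ ^ (g₁ 2 - k) * (-S₂ - (t₂ : R)) ^ k)
    (hy2q3 : ∀ (R : Type) [CommRing R] (φ : 𝓞 ↥(IntermediateField.adjoin ℚ ({β} : Set (AlgebraicClosure ℚ))) →+* R) (S₁ S₂ : R), S₁ ^ 2 = 2 → S₂ ^ 2 = 2 + S₁ →
      ∃ c : ℕ → R, φ y₀ + φ y₁ * S₁ + (φ y₂ + φ y₃ * S₁) * S₂ =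
        ∑ k ∈ Finset.range (g₁ 3 + 1), c k * φ q₂ ^ (g₁ 3 - k) * (S₂ - S₁ * S₂ - (t₂ : R)) ^ k)
    (εy : (𝓞 ↥(IntermediateField.adjoin ℚ ({β} : Set (AlgebraicClosure ℚ))))ˣ) (hNy : (y₀ ^ 2 + 2 * y₁ ^ 2 - 2 * y₂ ^ 2 - 4 * y₃ ^ 2 - 4 * y₂ * y₃) ^ 2 - 2 * (2 * y₀ * y₁ - y₂ ^ 2 - 2 * y₃ ^ 2 - 4 * y₂ * y₃) ^ 2 =
      εy * q₁ ^ (∑ i ∈ range 4, e₁ i) * q₂ ^ (∑ i ∈ range 4, g₁ i))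
    -- row 2
    (z₀ z₁ z₂ z₃ : 𝓞 ↥(IntermediateField.adjoin ℚ ({β} : Set (AlgebraicClosure ℚ))))
    (hz1q0 : ∀ (R : Type) [CommRing R] (φ : 𝓞 ↥(IntermediateField.adjoin ℚ ({β} : Set (AlgebraicClosure ℚ))) →+* R) (S₁ S₂ : R), S₁ ^ 2 = 2 → S₂ ^ 2 = 2 + S₁ →
      ∃ c : ℕ → R, φ z₀ + φ z₁ * S₁ + (φ z₂ + φ z₃ * S₁) * S₂ =
        ∑ k ∈ Finset.range (e₂ 0 + 1), c k * φ q₁ ^ (e₂ 0 - k) * (S₂ - (t₁ : R)) ^ k)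
    (hz1q1 : ∀ (R : Type) [CommRing R] (φ : 𝓞 ↥(IntermediateField.adjoin ℚ ({β} : Set (AlgebraicClosure ℚ))) →+* R) (S₁ S₂ : R), S₁ ^ 2 = 2 → S₂ ^ 2 = 2 + S₁ →
      ∃ c : ℕ → R, φ z₀ + φ z₁ * S₁ + (φ z₂ + φ z₃ * S₁) * S₂ =
        ∑ k ∈ Finset.range (e₂ 1 + 1), c k * φ q₁ ^ (e₂ 1 - k) * (S₁ * S₂ - S₂ - (t₁ : R)) ^ k)
    (hz1q2 : ∀ (R : Type) [CommRing R] (φ : 𝓞 ↥(IntermediateField.adjoin ℚ ({β} : Set (AlgebraicClosure ℚ))) →+* R) (S₁ S₂ : R), S₁ ^ 2 = 2 → S₂ ^ 2 = 2 + S₁ →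
      ∃ c : ℕ → R, φ z₀ + φ z₁ * S₁ + (φ z₂ + φ z₃ * S₁) * S₂ =
        ∑ k ∈ Finset.range (e₂ 2 + 1), c k * φ q₁ ^ (e₂ 2 - k) * (-S₂ - (t₁ : R)) ^ k)
    (hz1q3 : ∀ (R : Type) [CommRing R] (φ : 𝓞 ↥(IntermediateField.adjoin ℚ ({β} : Set (AlgebraicClosure ℚ))) →+* R) (S₁ S₂ : R), S₁ ^ 2 = 2 → S₂ ^ 2 = 2 + S₁ →
      ∃ c : ℕ → R, φ z₀ + φ z₁ * S₁ + (φ z₂ + φ z₃ * S₁) * S₂ =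
        ∑ k ∈ Finset.range (e₂ 3 + 1), c k * φ q₁ ^ (e₂ 3 - k) * (S₂ - S₁ * S₂ - (t₁ : R)) ^ k)
    (hz2q0 : ∀ (R : Type) [CommRing R] (φ : 𝓞 ↥(IntermediateField.adjoin ℚ ({β} : Set (AlgebraicClosure ℚ))) →+* R) (S₁ S₂ : R), S₁ ^ 2 = 2 → S₂ ^ 2 = 2 + S₁ →
      ∃ c : ℕ → R, φ z₀ + φ z₁ * S₁ + (φ z₂ + φ z₃ * S₁) * S₂ =
        ∑ k ∈ Finset.range (g₂ 0 + 1), c k * φ q₂ ^ (g₂ 0 - k) * (S₂ - (t₂ : R)) ^ k)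
    (hz2q1 : ∀ (R : Type) [CommRing R] (φ : 𝓞 ↥(IntermediateField.adjoin ℚ ({β} : Set (AlgebraicClosure ℚ))) →+* R) (S₁ S₂ : R), S₁ ^ 2 = 2 → S₂ ^ 2 = 2 + S₁ →
      ∃ c : ℕ → R, φ z₀ + φ z₁ * S₁ + (φ z₂ + φ z₃ * S₁) * S₂ =
        ∑ k ∈ Finset.range (g₂ 1 + 1), c k * φ q₂ ^ (g₂ 1 - k) * (S₁ * S₂ - S₂ - (t₂ : R)) ^ k)
    (hz2q2 : ∀ (R : Type) [CommRing R] (φ : 𝓞 ↥(IntermediateField.adjoin ℚ ({β} : Set (AlgebraicClosure ℚ))) →+* R) (S₁ S₂ : R), S₁ ^ 2 = 2 → S₂ ^ 2 = 2 + S₁ →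
      ∃ c : ℕ → R, φ z₀ + φ z₁ * S₁ + (φ z₂ + φ z₃ * S₁) * S₂ =
        ∑ k ∈ Finset.range (g₂ 2 + 1), c k * φ q₂ ^ (g₂ 2 - k) * (-S₂ - (t₂ : R)) ^ k)
    (hz2q3 : ∀ (R : Type) [CommRing R] (φ : 𝓞 ↥(IntermediateField.adjoin ℚ ({β} : Set (AlgebraicClosure ℚ))) →+* R) (S₁ S₂ : R), S₁ ^ 2 = 2 → S₂ ^ 2 = 2 + S₁ →
      ∃ c : ℕ → R, φ z₀ + φ z₁ * S₁ + (φ z₂ + φ z₃ * S₁) * S₂ =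
        ∑ k ∈ Finset.range (g₂ 3 + 1), c k * φ q₂ ^ (g₂ 3 - k) * (S₂ - S₁ * S₂ - (t₂ : R)) ^ k)
    (εz : (𝓞 ↥(IntermediateField.adjoin ℚ ({β} : Set (AlgebraicClosure ℚ))))ˣ) (hNz : (z₀ ^ 2 + 2 * z₁ ^ 2 - 2 * z₂ ^ 2 - 4 * z₃ ^ 2 - 4 * z₂ * z₃) ^ 2 - 2 * (2 * z₀ * z₁ - z₂ ^ 2 - 2 * z₃ ^ 2 - 4 * z₂ * z₃) ^ 2 =
      εz * q₁ ^ (∑ i ∈ range 4, e₂ i) * q₂ ^ (∑ i ∈ range 4, g₂ i)) :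
    (∀ l, classGroupPRank κP l ≤ d) ∧ ClassicalMuVanishes κP ∧ classicalLambda κP ≤ d := by
  have hirr := AlignedTransportAtTwoSeed.irr_two_of_forall_not_hasRationalTwoTorsionX W ht
  have hβint : IsIntegral ℚ β := ((AlgebraicClosure.isAlgebraic ℚ).isAlgebraic β).isIntegral
  haveI : FiniteDimensional ℚ ↥(IntermediateField.adjoin ℚ ({β} : Set (AlgebraicClosure ℚ))) := IntermediateField.adjoin.finiteDimensional hβint
  haveI : NumberField ↥(IntermediateField.adjoin ℚ ({β} : Set (AlgebraicClosure ℚ))) := NumberField.mk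
  haveI : Fact (Nat.Prime 2) := ⟨Nat.prime_two⟩
  have h3 : Module.finrank ℚ ↥(IntermediateField.adjoin ℚ ({β} : Set (AlgebraicClosure ℚ))) = 3 :=
    AddKatoTwo.finrank_adjoin_root_twoTorsionPolynomial_eq_three W hirr hβ
  have hodd3 : ¬ 2 ∣ Module.finrank ℚ ↥(IntermediateField.adjoin ℚ ({β} : Set (AlgebraicClosure ℚ))) := by rw [h3]; decide
  have hoddK : Odd (Module.finrank ℚ ↥(IntermediateField.adjoin ℚ ({β} : Set (AlgebraicClosure ℚ)))) :=
    Nat.odd_iff.mpr (Nat.two_dvd_ne_zero.mp hodd3)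
  -- unit rank `1` (`Δ_W < 0`: one real place)
  have hrank : Units.rank ↥(IntermediateField.adjoin ℚ ({β} : Set (AlgebraicClosure ℚ))) = 1 :=
    units_rank_eq_one_of_nrRealPlaces_eq_one _ h3 (nrRealPlaces_adjoin_root_twoTorsionPolynomial_eq_one W hΔ hirr hβ)
  -- at most three primes above `2` in the cubic field
  have h3card : {v : HeightOneSpectrum (𝓞 ↥(IntermediateField.adjoin ℚ ({β} : Set (AlgebraicClosure ℚ)))) | ((2 : ℕ) : 𝓞 ↥(IntermediateField.adjoin ℚ ({β} : Set (AlgebraicClosure ℚ)))) ∈ v.asIdeal}.ncard ≤ 3 := by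
    have hfin := finite_setOf_two_mem (F := ↥(IntermediateField.adjoin ℚ ({β} : Set (AlgebraicClosure ℚ))))
    rw [Set.ncard_eq_toFinset_card _ hfin, ← h3]
    exact card_le_finrank_of_forall_natCast_mem 2 hfin.toFinset fun v hv ↦ by
      simpa using (Set.Finite.mem_toFinset hfin).mp hv
  -- the three dyadic primes of degree one; all units `≡ ±1 (mod 𝔭_j³)`
  obtain ⟨h𝔭a, hPa0, h2Pa, hcarda⟩ := isPrime_and_mem_of_absNorm_eq_two 𝔭a hNa
  haveI := h𝔭a
  haveI : 𝔭a.IsMaximal := h𝔭a.isMaximal hPa0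
  have hresa := forall_mem_or_sub_one_mem_of_card_quotient_eq_two 𝔭a hcarda
  have hunitsa := forall_units_sub_one_mem_or_add_one_mem_of_rank_eq_one hoddK hrank 𝔭a hPa0 hresa h2Pa
    (two_not_mem_sq_of_not_dvd_discr hd 𝔭a h2Pa) hεa hnsq
  obtain ⟨h𝔭b, hPb0, h2Pb, hcardb⟩ := isPrime_and_mem_of_absNorm_eq_two 𝔭b hNb
  haveI := h𝔭b
  haveI : 𝔭b.IsMaximal := h𝔭b.isMaximal hPb0
  have hresb := forall_mem_or_sub_one_mem_of_card_quotient_eq_two 𝔭b hcardb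
  have hunitsb := forall_units_sub_one_mem_or_add_one_mem_of_rank_eq_one hoddK hrank 𝔭b hPb0 hresb h2Pb
    (two_not_mem_sq_of_not_dvd_discr hd 𝔭b h2Pb) hεb hnsq
  obtain ⟨h𝔭c, hPc0, h2Pc, hcardc⟩ := isPrime_and_mem_of_absNorm_eq_two 𝔭c hNc
  haveI := h𝔭c
  haveI : 𝔭c.IsMaximal := h𝔭c.isMaximal hPc0
  have hresc := forall_mem_or_sub_one_mem_of_card_quotient_eq_two 𝔭c hcardc
  have hunitsc := forall_units_sub_one_mem_or_add_one_mem_of_rank_eq_one hoddK hrank 𝔭c hPc0 hresc h2Pc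
    (two_not_mem_sq_of_not_dvd_discr hd 𝔭c h2Pc) hεc hnsq
  exact classicalMuVanishes_two_of_relationMatrixCert_layer_two hodd3 hd κP hκP h3card hh 𝔭a hresa h2Pa hunitsa 𝔭b hresb h2Pb hunitsb
    𝔭c hresc h2Pc hunitsc q₁ q₂ hq₁ hq₂ a₁₂ c₁₂ hq₁₂ hπa hπb hπc t₁ t₂ hm₁ hm₂ ψ₁ ψ₂ hψ₁ hψ₂ hti₁ hti₂ hPt₁ hPt₂ α₁ β₁ hBez₁ α₂ β₂ hBez₂
    α₁₁ v₁₁ hC₁₁ α₁₂ v₁₂ hC₁₂ α₁₃ v₁₃ hC₁₃ α₂₁ v₂₁ hC₂₁ α₂₂ v₂₂ hC₂₂ α₂₃ v₂₃ hC₂₃ e₁ g₁ e₂ g₂ hd2 hu hF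
    y₀ y₁ y₂ y₃ hy1q0 hy1q1 hy1q2 hy1q3 hy2q0 hy2q1 hy2q2 hy2q3 εy hNy z₀ z₁ z₂ z₃ hz1q0 hz1q1 hz1q2 hz1q3 hz2q0 hz2q1 hz2q2 hz2q3 εz hNz

end Summit.BirchSwinnertonDyer.BirchSwinnertonDyer.Theorems.AlignedTransportAtTwoCubicSplitStratumRelationMatrixCoordDoor

end
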